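import Literature.NumberTheory.QuadraticFields.JacobiCharacter
import HarnessLib

/-!
# The Kronecker character of an even discriminant `D = 4m` as a Dirichlet character mod `4|m|`

Topic `NumberTheory/QuadraticFields` (namespace `Literature.NumberTheory.QuadraticFields`).
Everything here is PROVED; there are no definitions (the character is produced by an existence
theorem and characterised by its values) and no named facts.

For an integer `m ≠ 0` the map `n ↦ (m / n)` (Jacobi symbol, `n` odd) only depends on `n` modulo
`4|m|` (Mathlib `jacobiSym.mod_right`, a form of quadratic reciprocity), so that

* `exists_dirichletCharacter_four_mul` — there is a Dirichlet character `χ` mod `4|m|` with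
  `χ(n) = (m / n)` for all odd `n` (and `χ(n) = 0` for even `n`).

For `D = 4m` with `m ≡ 2, 3 (mod 4)` squarefree — the even fundamental discriminants — this `χ` is
the Kronecker character `χ_D = (D / ·)` of `ℚ(√D)` (Cox, *Primes of the form x² + ny²*, §1.C,
Lemma 1.14 and (1.15)–(1.18); Davenport, *Multiplicative Number Theory*, Ch. 5; Montgomery–Vaughan
Thm. 9.13), and we prove, for any such `χ` (hypothesis `hχ : ∀ n odd, χ n = (m / n)`):

* `isQuadratic_of_forall_odd` — `χ` is quadratic;
* `apply_prime_eq_legendreSym_of_forall_odd` — `χ(ℓ) = (m / ℓ)` (Legendre symbol) at an odd prime `ℓ`;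
* `apply_neg_one_of_forall_odd` — `χ(−1) = −1` for `m < 0` (the character of an imaginary
  quadratic field is odd);
* `apply_natCast_eq_one_of_forall_prime` — `χ(N) = 1` for odd `N` all of whose prime factors `p`
  have `(m / p) = 1` (i.e. split in `ℚ(√D)`);
* `isPrimitive_of_forall_odd` — `χ` is **primitive** (conductor `4|m|`) when `m ≡ 2, 3 (mod 4)`
  is squarefree.

## References

* [Cox2013] D. A. Cox, *Primes of the form x² + ny²*, 2nd ed. (2013), §1.C Lemma 1.14, (1.15)–(1.18).
* [MontgomeryVaughan2007] H. L. Montgomery, R. C. Vaughan, *Multiplicative Number Theory I*, CUP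
  2007, §9.3, Theorem 9.13.
* H. Davenport, *Multiplicative Number Theory*, 3rd ed., GTM 74 (2000), Ch. 5.
-/

noncomputable section

open scoped NumberTheorySymbols

namespace Literature.NumberTheory.QuadraticFields

/-! ### Elementary values of Jacobi symbols -/

section Jacobi

/-- `J(b | t) = 1` when `b ≡ 1 (mod t)`. [folklore] -/
theorem jacobiSym_eq_one_of_emod_eq {b : ℤ} {t : ℕ} (h : b % t = 1 % t) : J(b | t) = 1 := by
  rw [jacobiSym.mod_left' h, jacobiSym.one_left]

/-- `J(b | t) = χ₄(t)` when `b ≡ −1 (mod t)` and `t` is odd. [folklore] -/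
theorem jacobiSym_eq_χ₄_of_emod_eq {b : ℤ} {t : ℕ} (ht : Odd t) (h : b % t = (-1) % t) :
    J(b | t) = ZMod.χ₄ t := by
  rw [jacobiSym.mod_left' h, jacobiSym.at_neg_one ht]

/-- `χ₈(b) = 1` for `b ≡ 7 (mod 8)` and `χ₈(b) = −1` for `b ≡ 5 (mod 8)`. [folklore] -/
theorem χ₈_nat_of_mod_eight {b : ℕ} :
    (b % 8 = 7 → ZMod.χ₈ b = 1) ∧ (b % 8 = 5 → ZMod.χ₈ b = -1) := by
  constructor <;> intro h <;> rw [ZMod.χ₈_nat_eq_if_mod_eight] <;> simp [h] <;> omega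

end Jacobi

/-! ### The character mod `4|m|` -/

section Character

variable (m : ℤ)

/-- **The Kronecker symbol `n ↦ (m / n)` as a Dirichlet character mod `4|m|`** (`m ≠ 0`): there is
a Dirichlet character `χ` modulo `4|m|` with `χ(n) = (m / n)` for every odd `n`. Well defined
because `(m / n)` depends only on `n mod 4|m|` for odd `n` (Mathlib `jacobiSym.mod_right`; Cox,
Lemma 1.14 and (1.18)); multiplicative in `n` (`jacobiSym.mul_right`); `0` off the units.
[cite: Cox2013, §1.C Lemma 1.14] -/
theorem exists_dirichletCharacter_four_mul (hm0 : m ≠ 0) :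
    ∃ χ : DirichletCharacter ℂ (4 * m.natAbs), ∀ n : ℕ, Odd n → χ n = (J(m | n) : ℂ) := by
  set q : ℕ := 4 * m.natAbs with hq
  have hq0 : q ≠ 0 := mul_ne_zero (by norm_num) (Int.natAbs_ne_zero.mpr hm0)
  haveI : NeZero q := ⟨hq0⟩
  have hq2 : 2 ∣ q := ⟨2 * m.natAbs, by rw [hq]; ring⟩
  haveI : Fact (1 < q) := ⟨by have := Int.natAbs_pos.mpr hm0; omega⟩
  -- parity of `x % q` is that of `x`
  have hpar : ∀ x : ℕ, Even (x % q) ↔ Even x := fun x ↦ by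
    have h2x : Even (q * (x / q)) := (even_iff_two_dvd.mpr hq2).mul_right _
    constructor
    · intro h
      rw [← Nat.mod_add_div x q]
      exact h.add h2x
    · intro h
      have h' : Even (x % q + q * (x / q)) := by rwa [Nat.mod_add_div]
      exact (Nat.even_add.mp h').mpr h2x
  -- the values
  set f : ZMod q → ℂ := fun a ↦ if Even a.val then 0 else (J(m | a.val) : ℂ) with hf
  have hf_odd : ∀ n : ℕ, Odd n → f n = (J(m | n) : ℂ) := fun n hn ↦ by
    have hodd : ¬ Even ((n : ZMod q).val) := by
      rw [ZMod.val_natCast, hpar]; exact Nat.not_even_iff_odd.mpr hn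
    simp only [hf, if_neg hodd]
    rw [ZMod.val_natCast, ← jacobiSym.mod_right m hn]
  have hf_even : ∀ a : ZMod q, Even a.val → f a = 0 := fun a ha ↦ by simp only [hf, if_pos ha]
  refine ⟨{ toFun := f, map_one' := ?_, map_mul' := ?_, map_nonunit' := ?_ }, ?_⟩
  · have h1 := hf_odd 1 odd_one
    rw [jacobiSym.one_right, Int.cast_one] at h1
    simpa using h1
  · intro a b
    have hab : (a * b).val = (a.val * b.val) % q := ZMod.val_mul a b
    by_cases ha : Even a.val
    · have h : Even (a * b).val := by rw [hab, hpar, Nat.even_mul]; exact Or.inl ha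
      rw [hf_even _ h, hf_even _ ha, zero_mul]
    · by_cases hb : Even b.val
      · have h : Even (a * b).val := by rw [hab, hpar, Nat.even_mul]; exact Or.inr hb
        rw [hf_even _ h, hf_even _ hb, mul_zero]
      · have ha' := Nat.not_even_iff_odd.mp ha
        have hb' := Nat.not_even_iff_odd.mp hb
        have hab' : ¬ Even (a * b).val := by
          rw [hab, hpar, Nat.even_mul, not_or]
          exact ⟨ha, hb⟩
        calc f (a * b) = (J(m | (a * b).val) : ℂ) := by simp only [hf, if_neg hab']
          _ = (J(m | a.val * b.val) : ℂ) := by rw [hab, ← jacobiSym.mod_right m (ha'.mul hb')]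
          _ = (J(m | a.val) : ℂ) * (J(m | b.val) : ℂ) := by
            rw [jacobiSym.mul_right' m ha'.pos.ne' hb'.pos.ne', Int.cast_mul]
          _ = f a * f b := by simp only [hf, if_neg ha, if_neg hb]
  · intro a ha
    by_cases hev : Even a.val
    · exact hf_even a hev
    · have hodd := Nat.not_even_iff_odd.mp hev
      rw [← ZMod.natCast_zmod_val a, hf_odd _ hodd, Int.cast_eq_zero]
      have hval : ¬ a.val.Coprime q := fun h ↦ ha (by
        rw [← ZMod.natCast_zmod_val a]
        exact (ZMod.isUnit_iff_coprime a.val q).mpr h)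
      haveI : NeZero a.val := ⟨hodd.pos.ne'⟩
      rw [jacobiSym.eq_zero_iff_not_coprime, Int.gcd_comm, Int.gcd_eq_natAbs, Int.natAbs_natCast]
      intro hcop
      apply hval
      change a.val.Coprime (4 * m.natAbs)
      refine Nat.Coprime.mul_right ?_ hcop
      exact Nat.Coprime.pow_right 2 (Nat.coprime_two_right.mpr hodd)
  · exact fun n hn ↦ hf_odd n hn

end Character

/-! ### Three reciprocity evaluations -/

section Reciprocity

/-- For `t` odd and `b ≡ 3 (mod 4)` with `b ≡ −1 (mod t)`: `J(t | b) = 1` (reciprocity: for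
`t ≡ 1 (mod 4)`, `J(t | b) = J(b | t) = (−1 / t) = 1`; for `t ≡ 3 (mod 4)`,
`J(t | b) = −J(b | t) = −(−1 / t) = 1`). [folklore] -/
theorem jacobiSym_eq_one_of_mod_four_eq_three_of_emod_eq_neg_one {t b : ℕ} (ht : Odd t)
    (hb4 : b % 4 = 3) (hbt : (b : ℤ) % t = (-1) % t) : J((t : ℤ) | b) = 1 := by
  rcases Nat.odd_mod_four_iff.mp (Nat.odd_iff.mp ht) with ht4 | ht4
  · rw [jacobiSym.quadratic_reciprocity_one_mod_four ht4 (Nat.odd_iff.mpr (by omega)),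
      jacobiSym_eq_χ₄_of_emod_eq ht hbt, ZMod.χ₄_nat_one_mod_four ht4]
  · rw [jacobiSym.quadratic_reciprocity_three_mod_four ht4 hb4, jacobiSym_eq_χ₄_of_emod_eq ht hbt,
      ZMod.χ₄_nat_three_mod_four ht4]
    norm_num

/-- For `t` odd and `b ≡ 3 (mod 4)` with `b ≡ 1 (mod t)`: `J(t | b) = χ₄(t)`. [folklore] -/
theorem jacobiSym_eq_χ₄_of_mod_four_eq_three_of_emod_eq_one {t b : ℕ} (ht : Odd t)
    (hb4 : b % 4 = 3) (hbt : (b : ℤ) % t = 1 % t) : J((t : ℤ) | b) = ZMod.χ₄ t := by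
  rcases Nat.odd_mod_four_iff.mp (Nat.odd_iff.mp ht) with ht4 | ht4
  · rw [jacobiSym.quadratic_reciprocity_one_mod_four ht4 (Nat.odd_iff.mpr (by omega)),
      jacobiSym_eq_one_of_emod_eq hbt, ZMod.χ₄_nat_one_mod_four ht4]
  · rw [jacobiSym.quadratic_reciprocity_three_mod_four ht4 hb4, jacobiSym_eq_one_of_emod_eq hbt,
      ZMod.χ₄_nat_three_mod_four ht4]

/-- For `t` odd and `b ≡ 1 (mod 4)` with `b ≡ 1 (mod t)`: `J(t | b) = 1`. [folklore] -/
theorem jacobiSym_eq_one_of_mod_four_eq_one_of_emod_eq_one {t b : ℕ} (ht : Odd t)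
    (hb4 : b % 4 = 1) (hbt : (b : ℤ) % t = 1 % t) : J((t : ℤ) | b) = 1 := by
  rw [jacobiSym.quadratic_reciprocity_one_mod_four' ht hb4, jacobiSym_eq_one_of_emod_eq hbt]

/-- `J(m | b) = J(−1 | b)^{[m < 0]} · J(|m| | b)` for odd `b`. [folklore] -/
theorem jacobiSym_eq_sign_mul_natAbs (m : ℤ) {b : ℕ} (hb : Odd b) :
    J(m | b) = (if m < 0 then ZMod.χ₄ b else 1) * J((m.natAbs : ℤ) | b) := by
  split_ifs with h
  · rw [show m = -(m.natAbs : ℤ) by omega, jacobiSym.neg _ hb, Int.natAbs_neg, Int.natAbs_natCast]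
  · rw [show m = (m.natAbs : ℤ) by omega, one_mul, Int.natAbs_natCast]

end Reciprocity

/-! ### Properties of the character from its values at odd `n` -/

section Properties

variable {m : ℤ} {χ : DirichletCharacter ℂ (4 * m.natAbs)}

/-- A character with `χ(n) = (m / n)` for odd `n` vanishes at the even residues. [folklore] -/
theorem apply_eq_zero_of_even [NeZero (4 * m.natAbs)] {a : ZMod (4 * m.natAbs)} (ha : Even a.val) :
    χ a = 0 := by
  refine MulChar.map_nonunit χ fun hu ↦ ?_
  have hcop : a.val.Coprime (4 * m.natAbs) := by
    have := ZMod.val_coe_unit_coprime hu.unit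
    rwa [IsUnit.unit_spec] at this
  have h2 : a.val.Coprime 2 := hcop.coprime_dvd_right ⟨2 * m.natAbs, by ring⟩
  exact (Nat.not_even_iff_odd.mpr (Nat.coprime_two_right.mp h2)) ha

/-- A character with `χ(n) = (m / n)` for odd `n` is quadratic. [folklore] -/
theorem isQuadratic_of_forall_odd (hm0 : m ≠ 0) (hχ : ∀ n : ℕ, Odd n → χ n = (J(m | n) : ℂ)) :
    χ.IsQuadratic := by
  haveI : NeZero (4 * m.natAbs) := ⟨mul_ne_zero (by norm_num) (Int.natAbs_ne_zero.mpr hm0)⟩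
  intro a
  by_cases ha : Even a.val
  · exact Or.inl (apply_eq_zero_of_even ha)
  · rw [← ZMod.natCast_zmod_val a, hχ _ (Nat.not_even_iff_odd.mp ha)]
    rcases jacobiSym.trichotomy m a.val with h | h | h <;> simp [h]

/-- At an odd prime `ℓ`: `χ(ℓ) = (m / ℓ)`, the Legendre symbol. [folklore] -/
theorem apply_prime_eq_legendreSym (hχ : ∀ n : ℕ, Odd n → χ n = (J(m | n) : ℂ)) {ℓ : ℕ}
    [Fact ℓ.Prime] (hℓ2 : ℓ ≠ 2) : χ ℓ = (legendreSym ℓ m : ℂ) := by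
  rw [hχ ℓ ((Fact.out : ℓ.Prime).odd_of_ne_two hℓ2), jacobiSym.legendreSym.to_jacobiSym]

/-- **`χ(−1) = −1` for `m < 0`** with `m ≡ 2, 3 (mod 4)`: the Kronecker character of an imaginary
quadratic field of even discriminant `4m` is odd. Computation: `χ(−1) = (m / 4|m| − 1)
= (−1 / 4|m|−1) · (|m| / 4|m|−1) = −1 · 1` (reciprocity). [cite: Cox2013, §1.C Lemma 1.14] -/
theorem apply_neg_one_of_forall_odd (hm : m < 0) (hm4 : m % 4 = 2 ∨ m % 4 = 3)
    (hχ : ∀ n : ℕ, Odd n → χ n = (J(m | n) : ℂ)) : χ (-1) = -1 := by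
  set n := m.natAbs with hn
  have hmn : m = -(n : ℤ) := by omega
  have hn0 : 0 < n := by omega
  haveI : NeZero (4 * n) := ⟨by omega⟩
  have hcast : ((4 * n - 1 : ℕ) : ZMod (4 * n)) = -1 := by
    rw [Nat.cast_sub (by omega), Nat.cast_one, ZMod.natCast_self, zero_sub]
  have hodd : Odd (4 * n - 1) := Nat.odd_iff.mpr (by omega)
  have hb4 : (4 * n - 1) % 4 = 3 := by omega
  rw [← hcast, hχ _ hodd, hmn, jacobiSym.neg _ hodd, ZMod.χ₄_nat_three_mod_four hb4]
  -- `J(n | 4n - 1) = 1`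
  suffices h : J((n : ℤ) | 4 * n - 1) = 1 by rw [h]; norm_num
  rcases hm4 with h4 | h4
  · -- `m ≡ 2 (mod 4)`: `n = 2 n₀` with `n₀` odd
    obtain ⟨n₀, hn₀⟩ : 2 ∣ n := by omega
    have hn₀2 : n₀ % 2 = 1 := by omega
    have hn₀odd : Odd n₀ := Nat.odd_iff.mpr hn₀2
    rw [show (n : ℤ) = 2 * (n₀ : ℤ) by rw [hn₀]; push_cast; ring, jacobiSym.mul_left,
      jacobiSym.at_two hodd, (χ₈_nat_of_mod_eight (b := 4 * n - 1)).1 (by omega), one_mul]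
    refine jacobiSym_eq_one_of_mod_four_eq_three_of_emod_eq_neg_one hn₀odd hb4 ?_
    rw [Nat.cast_sub (by omega)]
    push_cast
    rw [show (4 : ℤ) * (n : ℤ) - 1 = -1 + (n₀ : ℤ) * 8 by rw [hn₀]; push_cast; ring,
      Int.add_mul_emod_self_left]
  · -- `m ≡ 3 (mod 4)`: `n` odd
    have hnodd : Odd n := Nat.odd_iff.mpr (by omega)
    refine jacobiSym_eq_one_of_mod_four_eq_three_of_emod_eq_neg_one hnodd hb4 ?_
    rw [Nat.cast_sub (by omega)]
    push_cast
    rw [show (4 : ℤ) * (n : ℤ) - 1 = -1 + (n : ℤ) * 4 by ring, Int.add_mul_emod_self_left]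

/-- **`χ(N) = 1` when every prime factor of the odd number `N` has `(m / p) = 1`** (complete
multiplicativity). With `D = 4m = d_K` this is the Heegner hypothesis "every `p ∣ N` splits in
`K`" (`(d_K / p) = (m / p)` for odd `p`). [cite: Cox2013, §1.C Lemma 1.14] -/
theorem apply_natCast_eq_one_of_forall_prime (hχ : ∀ n : ℕ, Odd n → χ n = (J(m | n) : ℂ))
    {N : ℕ} (hN : Odd N) (h : ∀ p : ℕ, p.Prime → p ∣ N → J(m | p) = 1) : χ N = 1 := by
  induction N using Nat.recOnMul with
  | zero => exact absurd hN (by decide)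
  | one => rw [Nat.cast_one, map_one]
  | prime p hp => rw [hχ p hN, h p hp dvd_rfl, Int.cast_one]
  | mul a b iha ihb =>
    have ha : Odd a := (Nat.odd_mul.mp hN).1
    have hb : Odd b := (Nat.odd_mul.mp hN).2
    rw [Nat.cast_mul, map_mul, iha ha fun p hp hpa ↦ h p hp (hpa.mul_right b),
      ihb hb fun p hp hpb ↦ h p hp (hpb.mul_left a), one_mul]

/-- `J(a | b) = 1` when `b ≡ 1 (mod 4a)` (`b` odd): the Jacobi symbol in the lower argument has
period `4a` (Mathlib `jacobiSym.mod_right'`). [folklore] -/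
theorem jacobiSym_natCast_eq_one_of_mod_four_mul {a b : ℕ} (hb : Odd b)
    (h : b % (4 * a) = 1) : J((a : ℤ) | b) = 1 := by
  rw [jacobiSym.mod_right' a hb, h, jacobiSym.one_right]

/-- **The character mod `4|m|` with values `(m / n)` is primitive** for `m ≡ 2, 3 (mod 4)`
squarefree, i.e. the Kronecker character of the even fundamental discriminant `D = 4m` has
conductor `|D|` (Davenport Ch. 5; Montgomery–Vaughan Thm. 9.13; Cox Lemma 1.14). Proof: if `χ`
factored through its conductor `c ≠ 4|m|`, pick a prime `ℓ ∣ 4|m|/c`. If `ℓ = 2` then `c ∣ 2|m|`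
and `u = 1 + 2|m|` is a unit `≡ 1 (mod c)` with `χ(u) = (m / 1 + 2|m|) = −1` (this uses
`m ≡ 2, 3 (mod 4)`); if `ℓ` is odd then `c ∣ 4|m|/ℓ` and a unit `u ≡ 1 (mod 4|m|/ℓ)` which is a
non-residue mod `ℓ` has `χ(u) = (ℓ / u)(|m|/ℓ / u) = (u / ℓ) · 1 = −1` (this uses `ℓ² ∤ m`);
either way `χ(u) = 1` by the factorisation, a contradiction.
[cite: MontgomeryVaughan2007, Theorem 9.13] -/
theorem isPrimitive_of_forall_odd (hm4 : m % 4 = 2 ∨ m % 4 = 3) (hsq : Squarefree m)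
    (hχ : ∀ n : ℕ, Odd n → χ n = (J(m | n) : ℂ)) : χ.IsPrimitive := by
  have hm0 : m ≠ 0 := hsq.ne_zero
  have hn0 : 0 < m.natAbs := Int.natAbs_pos.mpr hm0
  have hsqn : Squarefree m.natAbs := Int.squarefree_natAbs.mpr hsq
  haveI : NeZero (4 * m.natAbs) := ⟨by omega⟩
  rw [DirichletCharacter.isPrimitive_def]
  have hcdvd : χ.conductor ∣ 4 * m.natAbs := DirichletCharacter.conductor_dvd_level χ
  have hft : χ.FactorsThrough χ.conductor := DirichletCharacter.factorsThrough_conductor χ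
  by_contra hne
  -- it suffices to find a unit `u ≡ 1 (mod c)` with `χ u = -1`
  suffices key : ∃ u : ℕ, u.Coprime (4 * m.natAbs) ∧ (u : ZMod χ.conductor) = 1 ∧ χ u = -1 by
    obtain ⟨u, hu, hu1, hχu⟩ := key
    have hker := (DirichletCharacter.factorsThrough_iff_ker_unitsMap hcdvd).mp hft
    have hx : ZMod.unitOfCoprime u hu ∈ (ZMod.unitsMap hcdvd).ker := by
      rw [MonoidHom.mem_ker, ZMod.unitsMap_def, Units.ext_iff, Units.coe_map, MonoidHom.coe_coe,
        ZMod.castHom_apply, Units.val_one, ZMod.coe_unitOfCoprime, ZMod.cast_natCast hcdvd]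
      exact hu1
    have h1 := hker hx
    rw [MonoidHom.mem_ker, Units.ext_iff, MulChar.coe_toUnitHom, Units.val_one,
      ZMod.coe_unitOfCoprime, hχu] at h1
    norm_num at h1
  -- a prime `ℓ` dividing `4|m| / c`
  obtain ⟨k, hk⟩ := hcdvd
  have hk1 : k ≠ 1 := fun h ↦ hne (by rw [h, mul_one] at hk; exact hk.symm)
  obtain ⟨ℓ, hℓ, hℓk⟩ := Nat.exists_prime_and_dvd hk1
  -- the sign of `m` does not matter at `u ≡ 1 (mod 4)`
  have hsign : ∀ {u : ℕ}, Odd u → u % 4 = 1 → J(m | u) = J((m.natAbs : ℤ) | u) := fun hu hu4 ↦ by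
    rw [jacobiSym_eq_sign_mul_natAbs m hu]
    split_ifs
    · rw [ZMod.χ₄_nat_one_mod_four hu4, one_mul]
    · rw [one_mul]
  have hcop4 : ∀ {u : ℕ}, Odd u → u.Coprime 4 := fun hu ↦ by
    simpa using Nat.Coprime.pow_right 2 (Nat.coprime_two_right.mpr hu)
  by_cases hℓ2 : ℓ = 2
  · /- `ℓ = 2`: `c ∣ 2|m|`; take `u = 1 + 2|m|` -/
    subst hℓ2
    obtain ⟨k', hk'⟩ := hℓk
    have hc2n : χ.conductor ∣ 2 * m.natAbs := ⟨k', by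
      have h4 : 4 * m.natAbs = 2 * (χ.conductor * k') :=
        calc 4 * m.natAbs = χ.conductor * k := hk
          _ = 2 * (χ.conductor * k') := by rw [hk']; ring
      omega⟩
    have huodd : Odd (1 + 2 * m.natAbs) := ⟨m.natAbs, by ring⟩
    refine ⟨1 + 2 * m.natAbs, ?_, ?_, ?_⟩
    · refine Nat.Coprime.mul_right (hcop4 huodd) ?_
      have h := (Nat.coprime_add_mul_left_left 1 m.natAbs 2).mpr (Nat.coprime_one_left _)
      rwa [mul_comm] at h
    · rw [Nat.cast_add, Nat.cast_one, (ZMod.natCast_eq_zero_iff (2 * m.natAbs) χ.conductor).mpr hc2n,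
        add_zero]
    · rw [hχ _ huodd]
      suffices h : J(m | 1 + 2 * m.natAbs) = -1 by rw [h]; norm_num
      rcases hm4 with h4 | h4
      · -- `m ≡ 2 (mod 4)`: `|m| = 2n₀`, `n₀` odd, `u = 4n₀ + 1 ≡ 5 (mod 8)`
        obtain ⟨n₀, hn₀⟩ : 2 ∣ m.natAbs := by omega
        have hn₀2 : n₀ % 2 = 1 := by omega
        have hn₀odd : Odd n₀ := Nat.odd_iff.mpr hn₀2
        have hu4 : (1 + 2 * m.natAbs) % 4 = 1 := by omega
        rw [hsign huodd hu4, show (m.natAbs : ℤ) = 2 * (n₀ : ℤ) by rw [hn₀]; push_cast; ring,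
          jacobiSym.mul_left, jacobiSym.at_two huodd,
          (χ₈_nat_of_mod_eight (b := 1 + 2 * m.natAbs)).2 (by omega),
          jacobiSym_eq_one_of_mod_four_eq_one_of_emod_eq_one hn₀odd hu4 ?_]
        · norm_num
        · rw [hn₀]
          push_cast
          rw [show (1 : ℤ) + 2 * (2 * (n₀ : ℤ)) = 1 + (n₀ : ℤ) * 4 by ring, Int.add_mul_emod_self_left]
      · -- `m ≡ 3 (mod 4)`: `|m|` odd, `u = 2|m| + 1 ≡ 3 (mod 4)`
        have hnodd : Odd m.natAbs := Nat.odd_iff.mpr (by omega)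
        have hu4 : (1 + 2 * m.natAbs) % 4 = 3 := by omega
        have hJn : J((m.natAbs : ℤ) | 1 + 2 * m.natAbs) = ZMod.χ₄ m.natAbs :=
          jacobiSym_eq_χ₄_of_mod_four_eq_three_of_emod_eq_one hnodd hu4 (by
            push_cast
            rw [show (1 : ℤ) + 2 * |m| = 1 + |m| * 2 by ring, Int.add_mul_emod_self_left])
        rw [jacobiSym_eq_sign_mul_natAbs m huodd, hJn]
        split_ifs with hneg
        · rw [ZMod.χ₄_nat_three_mod_four hu4, ZMod.χ₄_nat_one_mod_four (by omega)]
          norm_num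
        · rw [one_mul, ZMod.χ₄_nat_three_mod_four (by omega)]
  · /- `ℓ` odd: `ℓ ∣ |m|`, `c ∣ 4|m|/ℓ = 4n'`; take `u ≡ 1 (mod 4n')`, `u` a non-residue mod `ℓ` -/
    haveI := Fact.mk hℓ
    have hℓodd : Odd ℓ := hℓ.odd_of_ne_two hℓ2
    have hℓq : ℓ ∣ 4 * m.natAbs := hk ▸ hℓk.mul_left χ.conductor
    have hℓn : ℓ ∣ m.natAbs := (hcop4 hℓodd).dvd_of_dvd_mul_left hℓq
    obtain ⟨n', hn'⟩ := hℓn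
    have hn'0 : 0 < n' := Nat.pos_of_ne_zero fun h ↦ by rw [h, mul_zero] at hn'; omega
    have hℓn' : ¬ ℓ ∣ n' := fun h ↦ by
      have : ℓ * ℓ ∣ m.natAbs := hn' ▸ mul_dvd_mul_left ℓ h
      exact hℓ.one_lt.ne' (Nat.isUnit_iff.mp (hsqn ℓ this))
    -- `c ∣ 4 n'`
    have hc4n' : χ.conductor ∣ 4 * n' := by
      obtain ⟨k', hk'⟩ := hℓk
      refine ⟨k', Nat.eq_of_mul_eq_mul_left hℓ.pos ?_⟩
      calc ℓ * (4 * n') = 4 * m.natAbs := by rw [hn']; ring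
        _ = χ.conductor * k := hk
        _ = ℓ * (χ.conductor * k') := by rw [hk']; ring
    -- a non-residue `a` mod `ℓ` and `u ≡ a (mod ℓ)`, `u ≡ 1 (mod 4n')`
    have hcop : ℓ.Coprime (4 * n') :=
      Nat.Coprime.mul_right (hcop4 hℓodd) ((Nat.Prime.coprime_iff_not_dvd hℓ).mpr hℓn')
    have hchar : ringChar (ZMod ℓ) ≠ 2 := by rwa [ZMod.ringChar_zmod_n]
    obtain ⟨a, ha⟩ := quadraticChar_exists_neg_one hchar
    have ha0 : a ≠ 0 := by
      rintro rfl
      rw [MulChar.map_zero] at ha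
      norm_num at ha
    obtain ⟨u, hu1, hu2⟩ := Nat.chineseRemainder hcop a.val 1
    have huℓ : u % ℓ = a.val := by
      rw [show u % ℓ = a.val % ℓ from hu1, Nat.mod_eq_of_lt (ZMod.val_lt a)]
    have hu4n' : u % (4 * n') = 1 := by
      rw [show u % (4 * n') = 1 % (4 * n') from hu2, Nat.mod_eq_of_lt (by omega)]
    have hu4 : u % 4 = 1 := by
      have := Nat.mod_mod_of_dvd u (dvd_mul_right 4 n')
      rw [hu4n'] at this
      omega
    have huodd : Odd u := Nat.odd_iff.mpr (by omega)
    refine ⟨u, ?_, ?_, ?_⟩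
    · -- `u` is a unit mod `4|m| = ℓ · 4n'`
      have huℓ' : u.Coprime ℓ := by
        refine ((Nat.Prime.coprime_iff_not_dvd hℓ).mpr fun h ↦ ha0 ?_).symm
        rw [← ZMod.val_eq_zero, ← huℓ]
        exact Nat.mod_eq_zero_of_dvd h
      have hur : u.Coprime (4 * n') := by
        have h := Nat.ModEq.gcd_eq (hu2 : u ≡ 1 [MOD 4 * n'])
        rwa [Nat.gcd_one_left] at h
      rw [show 4 * m.natAbs = ℓ * (4 * n') by rw [hn']; ring]
      exact Nat.Coprime.mul_right huℓ' hur
    · have h := (ZMod.natCast_eq_natCast_iff u 1 χ.conductor).mpr (Nat.ModEq.of_dvd hc4n' hu2)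
      rwa [Nat.cast_one] at h
    · rw [hχ _ huodd, hsign huodd hu4, hn', Nat.cast_mul, jacobiSym.mul_left,
        jacobiSym.quadratic_reciprocity_one_mod_four' hℓodd hu4,
        jacobiSym_natCast_eq_one_of_mod_four_mul huodd hu4n', mul_one, ← jacobiSym_natCast_mod,
        huℓ, ← jacobiSym.legendreSym.to_jacobiSym, legendreSym, Int.cast_natCast, ZMod.natCast_zmod_val,
        ha]
      norm_num

end Properties

end Literature.NumberTheory.QuadraticFields

end
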